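import Summits.ResolutionOfSingularities.ResolutionOfSingularities.Theorems.FrobeniusLadderFRationalResolutionRetract
import Summits.ResolutionOfSingularities.ResolutionOfSingularities.Theorems.FrobeniusLadderFRationalResolutionRegularDomain
import Summits.ResolutionOfSingularities.ResolutionOfSingularities.Theorems.FrobeniusLadderFRationalResolutionVeroneseRetract
import Summits.ResolutionOfSingularities.ResolutionOfSingularities.Theorems.FrobeniusLadderFRationalResolutionVeroneseNotRegular
import Mathlib.RingTheory.RegularLocalRing.Polynomial
import HarnessLib

/-!
# The residual class of crux `FRationalResolution` is non-trivial inside Lean: the quadric cone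

Route `FrobeniusLadder`, crux stmt-ResolutionOfSingularities-15317, line `Sketch`. The standing
disprover's load-bearing analysis (Cruxes/FRationalResolution/Disproof.lean §4) lists as the missing
positive calibration "an F-rational NON-regular local ring in Lean (would show the residual class is
non-trivial inside Lean; needs tight closure of `k[x,y,z]/(xy−z²)`)". This file supplies it, in the
stronger weakly-F-regular form of rung 4′ (`stub_weaklyFRegularResolution`): for every prime `p` and
every field `k` of characteristic `p`, the Veronese cone ring `R = k[s², st, t²] ⊆ k[s, t]` (the
coordinate ring of the quadric cone `xy = z²`, an `A₁` surface singularity)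

* satisfies the inline clause "every ideal is tightly closed" — it is a direct summand of the regular
  domain `k[s, t]` (`veronese_retract`, p130706) and the clause descends to direct summands
  (`weaklyFRegularClause_of_retract`, p130188; Hochster–Huneke 1990 Prop. 4.12) from regular domains
  (`weaklyFRegularClause_of_isRegularRing`, p130225; Mathlib: polynomial rings over fields are
  `IsRegularRing`);
* and is NOT a regular ring (`veronese_not_isRegularRing`, p131049: embedding dimension `3 > 2` at
  the vertex).

So the class of rings on which rung 4′ (and a fortiori the crux, whose clause only asks for
parameter ideals) must work is strictly larger than "regular" in the tree's own terms; any engine for a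
future line has to resolve at least this cone (one blow-up of the vertex, classically).
-/

-- single-problem summit: the doubled namespace component `ResolutionOfSingularities` is forced
set_option linter.dupNamespace false

noncomputable section

open MvPolynomial

namespace Summit.ResolutionOfSingularities.ResolutionOfSingularities.Theorems.FRationalResolution

/-- **The quadric cone is weakly F-regular but not regular (all primes `p`, all fields `k` of
characteristic `p`).** With `R := k[s², st, t²] = Algebra.adjoin k {X 0 ^ 2, X 0 * X 1, X 1 ^ 2}`
inside `k[s,t] = MvPolynomial (Fin 2) k`: every ideal `I` of `R` is tightly closed in the inline
sense of route `FrobeniusLadder` (`c ≠ 0 ∧ (∀ e, c·y^(p^e) ∈ span {z^(p^e) | z ∈ I}) ⇒ y ∈ I`), and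
`R` is not a regular ring. -/
theorem veroneseCone_weaklyFRegular_not_isRegularRing (p : ℕ) [Fact p.Prime] (k : Type) [Field k]
    [CharP k p] :
    (∀ I : Ideal (Algebra.adjoin k ({MvPolynomial.X 0 ^ 2, MvPolynomial.X 0 * MvPolynomial.X 1,
        MvPolynomial.X 1 ^ 2} : Set (MvPolynomial (Fin 2) k))),
      ∀ y c : Algebra.adjoin k ({MvPolynomial.X 0 ^ 2, MvPolynomial.X 0 * MvPolynomial.X 1,
        MvPolynomial.X 1 ^ 2} : Set (MvPolynomial (Fin 2) k)), c ≠ 0 →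
      (∀ e : ℕ, c * y ^ p ^ e ∈ Ideal.span ((fun z : Algebra.adjoin k ({MvPolynomial.X 0 ^ 2,
        MvPolynomial.X 0 * MvPolynomial.X 1, MvPolynomial.X 1 ^ 2} : Set (MvPolynomial (Fin 2) k)) =>
          z ^ p ^ e) '' (I : Set _))) → y ∈ I) ∧
    ¬ IsRegularRing (Algebra.adjoin k ({MvPolynomial.X 0 ^ 2, MvPolynomial.X 0 * MvPolynomial.X 1,
        MvPolynomial.X 1 ^ 2} : Set (MvPolynomial (Fin 2) k))) := by
  refine ⟨?_, veronese_not_isRegularRing k⟩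
  obtain ⟨ρ, hρ⟩ := veronese_retract k
  haveI : CharP (MvPolynomial (Fin 2) k) p := inferInstance
  exact weaklyFRegularClause_of_retract p Subtype.val_injective ρ hρ
    (weaklyFRegularClause_of_isRegularRing p (MvPolynomial (Fin 2) k))

end Summit.ResolutionOfSingularities.ResolutionOfSingularities.Theorems.FRationalResolution

end
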